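import Mathlib.Analysis.Convex.Jensen
import Mathlib.Analysis.Convex.SpecificFunctions.Basic
import Mathlib.Analysis.Convex.Deriv
import Mathlib.Analysis.SpecialFunctions.Log.Deriv
import Mathlib.Algebra.BigOperators.Ring.Finset
import HarnessLib

/-!
# Growth of non-backtracking path counts (analytic half of the Alon–Hoory–Linial Moore bound)

Support file for the proof of `Literature.Combinatorics.SimpleGraph.alonHooryLinial_mooreBound`
(Alon–Hoory–Linial 2002, Theorem 1), see `MooreBound.lean` / `MooreBoundIrregular.lean`.
Declarations live in the sub-namespace `IrregularMoore` (the irregular Moore bound).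

Everything here is elementary real analysis, fully proved:

* `IrregularMoore.growth` — the abstract growth lemma.  For a finite symmetric neighbourhood
  structure `nbr : V → Finset V` in which every non-isolated vertex has at least two neighbours,
  and nonnegative dart weights `a j u v` (`u ∈ nbr v`) with `a 0 ≥ 1` and the super-recurrence
  `a (j+1) u v ≥ ∑ w ∈ (nbr v).erase u, a j v w`, one has
  `m · exp (j · Λ' / m) ≤ ∑_v ∑_{u ∈ nbr v} a j u v`, where `m = ∑_v #nbr v` and
  `Λ' = ∑_v #nbr v · log (#nbr v − 1)`.  This replaces the AM–GM / non-backtracking random walk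
  step `N_i ≥ Λ^i` of [AlonHooryLinial2002, p. 55] by a log-sum induction (Jensen for `log`
  vertex by vertex, then Jensen for `exp`); no walk space or transfer matrix is needed.
* `IrregularMoore.convexOn_add_one_mul_log` — convexity of `y ↦ (y+1) log y` on `[1, ∞)`
  (i.e. log-convexity of `(d-1)^d` for `d ≥ 2`, [AlonHooryLinial2002, p. 55]) and its Jensen
  consequence `IrregularMoore.sum_mul_log_sub_one_ge`:
  `m log (m/#S − 1) ≤ ∑_{v ∈ S} x_v log (x_v − 1)` when all `x_v ≥ 2` and `∑ x_v = m`.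

## References

* N. Alon, S. Hoory, N. Linial, The Moore bound for irregular graphs, *Graphs Combin.* 18
  (2002) 53–57 [AlonHooryLinial2002].
-/

namespace Literature.Combinatorics.SimpleGraph

namespace IrregularMoore

open Real Finset

section Convexity

/-- Log-convexity of `(y)^(y+1)`, i.e. convexity of `y ↦ (y + 1) log y` on `[1, ∞)`
(equivalently: `d ↦ (d-1)^d` is log-convex for `d ≥ 2`). [cite: AlonHooryLinial2002, p. 55] -/
theorem convexOn_add_one_mul_log :
    ConvexOn ℝ (Set.Ici (1 : ℝ)) (fun y : ℝ => (y + 1) * Real.log y) := by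
  apply convexOn_of_hasDerivWithinAt2_nonneg (convex_Ici 1)
    (f' := fun y => Real.log y + 1 + y⁻¹) (f'' := fun y => y⁻¹ - (y ^ 2)⁻¹)
  · apply ContinuousOn.mul (by fun_prop)
    exact Real.continuousOn_log.mono fun y hy => ne_of_gt (lt_of_lt_of_le zero_lt_one hy)
  · intro x hx
    rw [interior_Ici] at hx
    have hx0 : x ≠ 0 := ne_of_gt (lt_trans zero_lt_one hx)
    have h1 : HasDerivAt (fun y : ℝ => (y + 1) * Real.log y)
        (1 * Real.log x + (x + 1) * x⁻¹) x :=
      ((hasDerivAt_id x).add_const 1).mul (Real.hasDerivAt_log hx0)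
    refine (h1.congr_deriv ?_).hasDerivWithinAt
    field_simp
    ring
  · intro x hx
    rw [interior_Ici] at hx
    have hx0 : x ≠ 0 := ne_of_gt (lt_trans zero_lt_one hx)
    have h2 : HasDerivAt (fun y : ℝ => Real.log y + 1 + y⁻¹) (x⁻¹ + -(x ^ 2)⁻¹) x :=
      ((Real.hasDerivAt_log hx0).add_const 1).add (hasDerivAt_inv hx0)
    exact (h2.congr_deriv (by ring)).hasDerivWithinAt
  · intro x hx
    rw [interior_Ici] at hx
    have hx1 : (1 : ℝ) < x := hx
    have hle : (x ^ 2)⁻¹ ≤ x⁻¹ := by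
      apply inv_anti₀ (lt_trans zero_lt_one hx1)
      nlinarith
    linarith

/-- Jensen consequence of `convexOn_add_one_mul_log`: if `x_v ≥ 2` for all `v` in a nonempty
finite set `S` and `m = ∑_{v ∈ S} x_v`, then `m · log (m / #S - 1) ≤ ∑_{v ∈ S} x_v log (x_v - 1)`.
This is the inequality `Λ ≥ d̄ - 1` of [cite: AlonHooryLinial2002, p. 55]. -/
theorem sum_mul_log_sub_one_ge {ι : Type*} (S : Finset ι) (hS : S.Nonempty) (x : ι → ℝ)
    (hx : ∀ v ∈ S, 2 ≤ x v) :
    (∑ v ∈ S, x v) * Real.log ((∑ v ∈ S, x v) / #S - 1)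
      ≤ ∑ v ∈ S, x v * Real.log (x v - 1) := by
  have hSpos : (0 : ℝ) < #S := by exact_mod_cast hS.card_pos
  have hSne : (#S : ℝ) ≠ 0 := ne_of_gt hSpos
  have jen := convexOn_add_one_mul_log.map_sum_le (t := S) (w := fun _ => (#S : ℝ)⁻¹)
    (p := fun v => x v - 1) (fun _ _ => by positivity)
    (by simp [Finset.sum_const, nsmul_eq_mul, mul_inv_cancel₀ hSne])
    (fun v hv => by simp only [Set.mem_Ici]; linarith [hx v hv])
  simp only [smul_eq_mul] at jen
  have hsum : ∑ v ∈ S, (#S : ℝ)⁻¹ * (x v - 1) = (∑ v ∈ S, x v) / #S - 1 := by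
    rw [← Finset.mul_sum, Finset.sum_sub_distrib]
    simp only [Finset.sum_const, nsmul_eq_mul, mul_one]
    field_simp
  rw [hsum, ← Finset.mul_sum] at jen
  have jen' := mul_le_mul_of_nonneg_left jen (le_of_lt hSpos)
  have lhs : (#S : ℝ) * (((∑ v ∈ S, x v) / #S - 1 + 1) * Real.log ((∑ v ∈ S, x v) / #S - 1))
      = (∑ v ∈ S, x v) * Real.log ((∑ v ∈ S, x v) / #S - 1) := by
    field_simp
    ring
  have rhs : (#S : ℝ) * ((#S : ℝ)⁻¹ * ∑ v ∈ S, (x v - 1 + 1) * Real.log (x v - 1))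
      = ∑ v ∈ S, x v * Real.log (x v - 1) := by
    rw [← mul_assoc, mul_inv_cancel₀ hSne, one_mul]
    refine Finset.sum_congr rfl fun v _ => by ring
  linarith [jen', lhs, rhs]

end Convexity

section Growth

variable {V : Type*} [Fintype V] [DecidableEq V]

/-- Swapping a double sum over a symmetric neighbourhood structure. [folklore] -/
theorem sum_nbr_comm (nbr : V → Finset V) (hsymm : ∀ u v, u ∈ nbr v → v ∈ nbr u)
    (F : V → V → ℝ) :
    ∑ v, ∑ u ∈ nbr v, F u v = ∑ u, ∑ v ∈ nbr u, F u v := by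
  have h1 : ∀ v, ∑ u ∈ nbr v, F u v = ∑ u, if u ∈ nbr v then F u v else 0 := by
    intro v
    rw [← Finset.sum_filter]
    congr 1
    ext u
    simp
  have h2 : ∀ u, ∑ v ∈ nbr u, F u v = ∑ v, if u ∈ nbr v then F u v else 0 := by
    intro u
    rw [← Finset.sum_filter]
    congr 1
    ext v
    simp only [Finset.mem_filter, Finset.mem_univ, true_and]
    exact ⟨fun h => hsymm _ _ h, fun h => hsymm _ _ h⟩
  simp_rw [h1, h2]
  exact Finset.sum_comm

omit [Fintype V] in
/-- The erase-sum identity `∑_{u ∈ T} ∑_{w ∈ T \ {u}} F w = (#T - 1) ∑_{w ∈ T} F w`. [folklore] -/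
theorem sum_sum_erase (T : Finset V) (F : V → ℝ) :
    ∑ u ∈ T, ∑ w ∈ T.erase u, F w = ((#T : ℝ) - 1) * ∑ w ∈ T, F w := by
  have : ∀ u ∈ T, ∑ w ∈ T.erase u, F w = (∑ w ∈ T, F w) - F u := by
    intro u hu
    rw [Finset.sum_erase_eq_sub hu]
  rw [Finset.sum_congr rfl this, Finset.sum_sub_distrib, Finset.sum_const, nsmul_eq_mul]
  ring

/-! ### The growth lemma

Hypotheses (kept unbundled): a symmetric neighbourhood structure `nbr` whose non-isolated
vertices have at least two neighbours (`hsymm`, `htwo`), and dart weights `a j u v` (`u ∈ nbr v`)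
with `a 0 ≥ 1` (`h0`) satisfying the non-backtracking super-recurrence up to level `J` (`hrec`). -/

variable {nbr : V → Finset V} {a : ℕ → V → V → ℝ} {J : ℕ}
  (hsymm : ∀ u v, u ∈ nbr v → v ∈ nbr u)
  (htwo : ∀ v, (nbr v).Nonempty → 2 ≤ #(nbr v))
  (h0 : ∀ v, ∀ u ∈ nbr v, 1 ≤ a 0 u v)
  (hrec : ∀ j < J, ∀ v, ∀ u ∈ nbr v, ∑ w ∈ (nbr v).erase u, a j v w ≤ a (j + 1) u v)
include hsymm htwo h0 hrec

omit [Fintype V] in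
/-- Positivity: all weights up to level `J` are at least `1`.
[cite: AlonHooryLinial2002, p. 55] -/
theorem growth_one_le :
    ∀ j ≤ J, ∀ v, ∀ u ∈ nbr v, 1 ≤ a j u v := by
  intro j
  induction j with
  | zero => intro _ v u hu; exact h0 v u hu
  | succ j ih =>
    intro hj v u hu
    have hj' : j < J := hj
    have hcard : 2 ≤ #(nbr v) := htwo v ⟨u, hu⟩
    have hcard' : (1 : ℝ) ≤ #((nbr v).erase u) := by
      rw [Finset.card_erase_of_mem hu]
      have : 1 ≤ #(nbr v) - 1 := by omega
      exact_mod_cast this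
    calc (1 : ℝ) ≤ #((nbr v).erase u) := hcard'
      _ = ∑ w ∈ (nbr v).erase u, (1 : ℝ) := by simp
      _ ≤ ∑ w ∈ (nbr v).erase u, a j v w := by
          refine Finset.sum_le_sum fun w hw => ?_
          exact ih hj'.le w v (hsymm _ _ (Finset.mem_of_mem_erase hw))
      _ ≤ a (j + 1) u v := hrec j hj' v u hu

/-- The log-sum induction: `j · ∑_v #nbr v · log (#nbr v - 1) ≤ ∑_v ∑_{u ∈ nbr v} log (a j u v)`
for `j ≤ J`.  (Entropy-free replacement of `N_j ≥ Λ^j`, [cite: AlonHooryLinial2002, p. 55].) -/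
theorem growth_sum_log :
    ∀ j ≤ J, (j : ℝ) * ∑ v, (#(nbr v) : ℝ) * Real.log (#(nbr v) - 1)
      ≤ ∑ v, ∑ u ∈ nbr v, Real.log (a j u v) := by
  intro j
  induction j with
  | zero =>
    intro hJ
    simp only [CharP.cast_eq_zero, zero_mul]
    refine Finset.sum_nonneg fun v _ => Finset.sum_nonneg fun u hu => ?_
    exact Real.log_nonneg (growth_one_le hsymm htwo h0 hrec 0 hJ v u hu)
  | succ j ih =>
    intro hj
    have hj' : j < J := hj
    -- the vertexwise estimate
    have key : ∀ v, (#(nbr v) : ℝ) * Real.log (#(nbr v) - 1) + ∑ w ∈ nbr v, Real.log (a j v w)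
        ≤ ∑ u ∈ nbr v, Real.log (a (j + 1) u v) := by
      intro v
      rcases (nbr v).eq_empty_or_nonempty with hv | hv
      · simp [hv]
      have hcard : 2 ≤ #(nbr v) := htwo v hv
      set c : ℝ := (#(nbr v) : ℝ) - 1 with hc
      have hcpos : 0 < c := by
        have : (2 : ℝ) ≤ #(nbr v) := by exact_mod_cast hcard
        linarith
      have hcu : ∀ u ∈ nbr v, (#((nbr v).erase u) : ℝ) = c := by
        intro u hu
        rw [Finset.card_erase_of_mem hu, Nat.cast_sub (by omega)]
        simp [hc]
      -- Jensen for `log` at each dart `(u, v)`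
      have step : ∀ u ∈ nbr v,
          Real.log c + c⁻¹ * ∑ w ∈ (nbr v).erase u, Real.log (a j v w)
            ≤ Real.log (a (j + 1) u v) := by
        intro u hu
        have hpos : ∀ w ∈ (nbr v).erase u, 0 < a j v w := fun w hw =>
          lt_of_lt_of_le zero_lt_one (growth_one_le hsymm htwo h0 hrec j hj'.le w v
            (hsymm _ _ (Finset.mem_of_mem_erase hw)))
        have jen := (strictConcaveOn_log_Ioi.concaveOn).le_map_sum (t := (nbr v).erase u)
          (w := fun _ => c⁻¹) (p := fun w => a j v w) (fun _ _ => by positivity)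
          (by rw [Finset.sum_const, nsmul_eq_mul, hcu u hu, mul_inv_cancel₀ (ne_of_gt hcpos)])
          (fun w hw => hpos w hw)
        simp only [smul_eq_mul] at jen
        rw [← Finset.mul_sum, ← Finset.mul_sum] at jen
        have hspos : 0 < ∑ w ∈ (nbr v).erase u, a j v w := by
          apply Finset.sum_pos hpos
          rw [← Finset.card_pos, Finset.card_erase_of_mem hu]
          omega
        calc Real.log c + c⁻¹ * ∑ w ∈ (nbr v).erase u, Real.log (a j v w)
            ≤ Real.log c + Real.log (c⁻¹ * ∑ w ∈ (nbr v).erase u, a j v w) := by linarith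
          _ = Real.log (∑ w ∈ (nbr v).erase u, a j v w) := by
              rw [← Real.log_mul (ne_of_gt hcpos) (by positivity), ← mul_assoc,
                mul_inv_cancel₀ (ne_of_gt hcpos), one_mul]
          _ ≤ Real.log (a (j + 1) u v) := Real.log_le_log hspos (hrec j hj' v u hu)
      have hsum := Finset.sum_le_sum step
      rw [Finset.sum_add_distrib, Finset.sum_const, nsmul_eq_mul, ← Finset.mul_sum,
        sum_sum_erase, ← mul_assoc, ← hc, inv_mul_cancel₀ (ne_of_gt hcpos), one_mul] at hsum
      simpa [hc] using hsum
    have hswap : ∑ v, ∑ w ∈ nbr v, Real.log (a j v w) = ∑ v, ∑ u ∈ nbr v, Real.log (a j u v) :=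
      (sum_nbr_comm nbr hsymm (fun u v => Real.log (a j u v))).symm
    calc ((j + 1 : ℕ) : ℝ) * ∑ v, (#(nbr v) : ℝ) * Real.log (#(nbr v) - 1)
        = (j : ℝ) * ∑ v, (#(nbr v) : ℝ) * Real.log (#(nbr v) - 1)
          + ∑ v, (#(nbr v) : ℝ) * Real.log (#(nbr v) - 1) := by push_cast; ring
      _ ≤ ∑ v, ∑ u ∈ nbr v, Real.log (a j u v)
          + ∑ v, (#(nbr v) : ℝ) * Real.log (#(nbr v) - 1) := by linarith [ih hj'.le]
      _ = ∑ v, ((#(nbr v) : ℝ) * Real.log (#(nbr v) - 1)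
          + ∑ w ∈ nbr v, Real.log (a j v w)) := by
          rw [Finset.sum_add_distrib, hswap, add_comm]
      _ ≤ ∑ v, ∑ u ∈ nbr v, Real.log (a (j + 1) u v) := Finset.sum_le_sum fun v _ => key v

/-- **Growth lemma** (entropy-free form of `N_j ≥ Λ^j`, [cite: AlonHooryLinial2002, p. 55]):
with `m = ∑_v #nbr v` (the number of darts) and `Λ' = ∑_v #nbr v · log (#nbr v - 1)`,
`m · exp (j Λ' / m) ≤ ∑_v ∑_{u ∈ nbr v} a j u v` for all `j ≤ J`. -/
theorem growth {j : ℕ} (hj : j ≤ J) :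
    (∑ v, (#(nbr v) : ℝ)) *
        Real.exp ((j : ℝ) * (∑ v, (#(nbr v) : ℝ) * Real.log (#(nbr v) - 1))
          / ∑ v, (#(nbr v) : ℝ))
      ≤ ∑ v, ∑ u ∈ nbr v, a j u v := by
  have hlog := growth_sum_log hsymm htwo h0 hrec j hj
  have hm : (∑ v, (#(nbr v) : ℝ)) = #(Finset.univ.sigma nbr) := by
    rw [Finset.card_sigma, Nat.cast_sum]
  have hnonneg : 0 ≤ ∑ v, ∑ u ∈ nbr v, a j u v :=
    Finset.sum_nonneg fun v _ => Finset.sum_nonneg fun u hu =>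
      le_trans zero_le_one (growth_one_le hsymm htwo h0 hrec j hj v u hu)
  have hm0 : (0 : ℝ) ≤ ∑ v, (#(nbr v) : ℝ) :=
    Finset.sum_nonneg fun v _ => Nat.cast_nonneg _
  generalize hΛ : (∑ v, (#(nbr v) : ℝ) * Real.log (#(nbr v) - 1)) = Λ at hlog ⊢
  generalize hm_def : (∑ v, (#(nbr v) : ℝ)) = m at hm hm0 ⊢
  rcases hm0.eq_or_lt with hm00 | hmpos
  · rw [← hm00, zero_mul]
    exact hnonneg
  have hmne : m ≠ 0 := ne_of_gt hmpos
  -- Jensen for `exp` over the darts, written as the sigma finset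
  have jen := convexOn_exp.map_sum_le (t := Finset.univ.sigma nbr)
    (w := fun _ => m⁻¹)
    (p := fun s => Real.log (a j s.2 s.1)) (fun _ _ => inv_nonneg.mpr (le_of_lt hmpos))
    (by rw [Finset.sum_const, nsmul_eq_mul, ← hm, mul_inv_cancel₀ hmne])
    (fun _ _ => Set.mem_univ _)
  have hL : ∑ s ∈ Finset.univ.sigma nbr, m⁻¹ • Real.log (a j s.2 s.1)
      = m⁻¹ * ∑ v, ∑ u ∈ nbr v, Real.log (a j u v) := by
    rw [Finset.sum_sigma, Finset.mul_sum]
    refine Finset.sum_congr rfl fun v _ => ?_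
    rw [Finset.mul_sum]
    rfl
  have hR : ∑ s ∈ Finset.univ.sigma nbr, m⁻¹ • Real.exp (Real.log (a j s.2 s.1))
      = m⁻¹ * ∑ v, ∑ u ∈ nbr v, a j u v := by
    rw [Finset.sum_sigma, Finset.mul_sum]
    refine Finset.sum_congr rfl fun v _ => ?_
    rw [Finset.mul_sum]
    refine Finset.sum_congr rfl fun u hu => ?_
    change m⁻¹ * Real.exp (Real.log (a j u v)) = m⁻¹ * a j u v
    rw [Real.exp_log (lt_of_lt_of_le zero_lt_one (growth_one_le hsymm htwo h0 hrec j hj v u hu))]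
  rw [hL, hR] at jen
  have h1 : (j : ℝ) * Λ / m ≤ m⁻¹ * ∑ v, ∑ u ∈ nbr v, Real.log (a j u v) := by
    rw [div_eq_inv_mul]
    exact mul_le_mul_of_nonneg_left hlog (inv_nonneg.mpr (le_of_lt hmpos))
  calc m * Real.exp ((j : ℝ) * Λ / m)
      ≤ m * Real.exp (m⁻¹ * ∑ v, ∑ u ∈ nbr v, Real.log (a j u v)) :=
        mul_le_mul_of_nonneg_left (Real.exp_le_exp.mpr h1) (le_of_lt hmpos)
    _ ≤ m * (m⁻¹ * ∑ v, ∑ u ∈ nbr v, a j u v) :=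
        mul_le_mul_of_nonneg_left jen (le_of_lt hmpos)
    _ = ∑ v, ∑ u ∈ nbr v, a j u v := by
        rw [← mul_assoc, mul_inv_cancel₀ hmne, one_mul]

end Growth

end IrregularMoore

end Literature.Combinatorics.SimpleGraph
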